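import Summits.Ventures.CertifiedArithmetic.LowPrec.SRDyadicThresholds
import HarnessLib

/-!
# The grid theorem: in every binary format, `L = log₂(ulp_max/ulp_min)` random bits reproduce exact SR

HONEST FRAMING: certified error envelopes and provably optimal rounding/accumulation schemes for
low-precision formats under stated cost models; every table by two implementations; no hardware or
vendor claims.

File LXXIX of the SR slice.  `SRDyadicThresholds` (LXXVII) and `SRInnerProductLimitedBits` (LXXVIII)
certified, format by format and by kernel enumeration, the number of random bits after which the
IEEE P3109 rules `StochasticA/B/C` reproduce the exact-SR law of a whole computation, and the HOME
certificates observed the law `PAIRS = log₂(ulp_max/ulp_min)`, `IP1 = log₂(ulp_max/ulp_min²)` on three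
formats.  This file PROVES that law as an upper bound for EVERY format of the following shape, with
no enumeration over states:

`GridFormat F u L` — every value of `F` is an integer multiple of the quantum `u > 0` (the subnormal
spacing), and any two ADJACENT values of `F` differ by `2^l u` for some `l ≤ L` (cell widths are
power-of-two multiples of the quantum, at most `2^L u = ulp_max`).  Every binary floating-point format
with subnormals (any exponent range, any precision, signed, with or without saturation values that are
themselves on the grid) is a grid format with `L = log₂(ulp_max/ulp_min)`; so are the integer formats
(`L = 0`) and block-scaled element grids.  Decidable; kernel instances `e2m1_grid (u = ½, L = 2)`,
`e3m2_grid (1/16, 6)`, `e2m3_grid (⅛, 2)`.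

* `dyadic_pUp_of_grid` — THE GRID THEOREM: for a grid format and ANY pre-rounding value `c` on the grid
  `uℤ` (in or out of range: saturation included), the up-probability `pUp F c` is an `L`-bit dyadic.
  (Proof: the two candidates are adjacent members of `F`, so the cell has width `2^l u`, and the clamped
  `c` is on the grid.)
* consequences for whole computations under any rule fixing the `L`-bit dyadics (so `A`, `B`, `C` with
  `N ≥ L` bits, `probAwayABC_of_dyadic_le`): `treeExpQ_eq_treeExp_of_grid` (every summation tree whose
  leaves are grid values — format data, or any multiples of `u` — in any order, for every test
  function), `accExpQ_eq_accExp_of_grid` (every accumulation of grid increments from a format start,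
  every length), `recExpQ_eq_recExp_of_grid` (every recursion whose updates keep format states on the
  grid);
* PRODUCTS: `gridFormat_refine` — a grid format with quantum `u = 2^{-j}`-times-coarser is a grid format
  for the finer quantum with `L + j`; hence (`accExpQ_eq_accExp_of_grid_mul`) inner products of grid
  vectors, one-stage, are exact with `L + j` bits where `u·2^j = 1` (`= log₂(ulp_max/ulp_min²)`), and
  dot-product trees likewise (`treeExpQ_eq_treeExp_of_grid_mul`);
* the format instances turn LXXVII/LXXVIII's FP4 tables into one-line corollaries and add the FP6 ones
  as THEOREMS: `e3m2_sixBits_tree_exact` (**six random bits reproduce exact SR on every E3M2 summation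
  tree**, sharp: `e3m2_fiveBits_witness`, `-28 + 1/16`), `e2m3_twoBits_tree_exact` (two bits for every
  E2M3 tree; sharp by `-15/2 + ⅛`), `e3m2_tenBits_ip_exact` / `e2m3_fiveBits_ip_exact` (one-stage inner
  products: ten and five bits; sharp by the LXXVIII witnesses).
= HOME `certs/sr/gen15/thresholds` + `certs/sr/gen15/ipthr` rows PAIRS / IP1 / DOTPAIRS (the certified
values 2, 6, 2 and 3, 10, 5 are exactly the grid bounds: the bound is attained on all three formats).
-/

namespace Summit.Ventures.CertifiedArithmetic.LowPrec.SR.LimitedBits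

open Literature.ComputerArithmetic.P3109
open Literature.ComputerArithmetic.ConnollyHighamMary2021
open Summit.Ventures.CertifiedArithmetic.LowPrec.SR
open Finset STree

section Generic

variable {K : Type*} [Field K] [LinearOrder K] [IsStrictOrderedRing K] [FloorRing K]

/-! ### Grids and grid formats -/

/-- `OnGrid u x`: `x` is an integer multiple of the quantum `u`. -/
def OnGrid (u x : K) : Prop := ∃ m : ℤ, x = m * u

omit [LinearOrder K] [IsStrictOrderedRing K] [FloorRing K] in
/-- Grid values are closed under addition. -/
theorem OnGrid.add {u x y : K} (hx : OnGrid u x) (hy : OnGrid u y) : OnGrid u (x + y) := by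
  obtain ⟨m, rfl⟩ := hx; obtain ⟨n, rfl⟩ := hy; exact ⟨m + n, by push_cast; ring⟩

omit [LinearOrder K] [IsStrictOrderedRing K] [FloorRing K] in
/-- Grid values are closed under subtraction. -/
theorem OnGrid.sub {u x y : K} (hx : OnGrid u x) (hy : OnGrid u y) : OnGrid u (x - y) := by
  obtain ⟨m, rfl⟩ := hx; obtain ⟨n, rfl⟩ := hy; exact ⟨m - n, by push_cast; ring⟩

omit [LinearOrder K] [IsStrictOrderedRing K] [FloorRing K] in
/-- The product of a `u`-grid value and a `v`-grid value is on the `uv`-grid. -/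
theorem OnGrid.mul {u v x y : K} (hx : OnGrid u x) (hy : OnGrid v y) : OnGrid (u * v) (x * y) := by
  obtain ⟨m, rfl⟩ := hx; obtain ⟨n, rfl⟩ := hy; exact ⟨m * n, by push_cast; ring⟩

omit [LinearOrder K] [IsStrictOrderedRing K] [FloorRing K] in
/-- A coarser grid lies on a finer one: `u = 2^j v`. -/
theorem OnGrid.refine {u v x : K} {j : ℕ} (huv : u = 2 ^ j * v) (hx : OnGrid u x) : OnGrid v x := by
  obtain ⟨m, rfl⟩ := hx; exact ⟨m * 2 ^ j, by rw [huv]; push_cast; ring⟩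

/-- Floor test for grid membership (nonzero quantum). -/
theorem onGrid_iff_floor {u : K} (hu : u ≠ 0) (x : K) :
    OnGrid u x ↔ ((⌊x / u⌋ : ℤ) : K) * u = x := by
  constructor
  · rintro ⟨m, rfl⟩
    rw [mul_div_assoc, div_self hu, mul_one, Int.floor_intCast]
  · intro h; exact ⟨⌊x / u⌋, h.symm⟩

/-- Grid membership is decidable (by the floor test; quantum `0` means `x = 0`). -/
instance instDecidableOnGrid [DecidableEq K] (u x : K) : Decidable (OnGrid u x) :=
  if hu : u = 0 then decidable_of_iff (x = 0) (by
    subst hu; constructor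
    · intro hx; exact ⟨0, by simp [hx]⟩
    · rintro ⟨m, hm⟩; simpa using hm)
  else decidable_of_iff _ (onGrid_iff_floor hu x).symm

/-- `GridFormat F u L`: every value of `F` is a multiple of the quantum `u`, and two values of `F` with
no value of `F` strictly between them differ by `2^l u` for some `l ≤ L`.  Decidable. -/
def GridFormat (F : Finset K) (u : K) (L : ℕ) : Prop :=
  (∀ x ∈ F, OnGrid u x) ∧
    ∀ x ∈ F, ∀ y ∈ F, x < y → (∃ z ∈ F, x < z ∧ z < y) ∨ ∃ l ∈ Finset.range (L + 1), y - x = 2 ^ l * u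

/-- Decidability of `GridFormat`. -/
instance instDecidableGridFormat [DecidableEq K] (F : Finset K) (u : K) (L : ℕ) :
    Decidable (GridFormat F u L) := by
  unfold GridFormat; infer_instance

omit [IsStrictOrderedRing K] [FloorRing K] in
/-- A larger width budget is still a grid format. -/
theorem GridFormat.mono {F : Finset K} {u : K} {L M : ℕ} (hLM : L ≤ M) (h : GridFormat F u L) :
    GridFormat F u M := by
  refine ⟨h.1, fun x hx y hy hxy => (h.2 x hx y hy hxy).imp_right ?_⟩
  rintro ⟨l, hl, he⟩
  exact ⟨l, Finset.mem_range.mpr (lt_of_lt_of_le (Finset.mem_range.mp hl) (by omega)), he⟩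

omit [IsStrictOrderedRing K] [FloorRing K] in
/-- **Refinement.** A grid format for the quantum `u = 2^j v` is a grid format for the finer quantum
`v` with width budget `L + j`. -/
theorem gridFormat_refine {F : Finset K} {u v : K} {L j : ℕ} (huv : u = 2 ^ j * v)
    (h : GridFormat F u L) : GridFormat F v (L + j) := by
  refine ⟨fun x hx => (h.1 x hx).refine huv, fun x hx y hy hxy => (h.2 x hx y hy hxy).imp_right ?_⟩
  rintro ⟨l, hl, he⟩
  refine ⟨l + j, Finset.mem_range.mpr (by have := Finset.mem_range.mp hl; omega), ?_⟩
  rw [he, huv, pow_add]; ring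

/-! ### The grid theorem -/

omit [Field K] [IsStrictOrderedRing K] [FloorRing K] in
/-- The clamped value is either the input or a format value. -/
theorem clamp_eq_self_or_mem {F : Finset K} (hF : F.Nonempty) (c : K) :
    clamp F c = c ∨ clamp F c ∈ F := by
  unfold clamp; rw [dif_pos hF]
  rcases le_total (F.min' hF) (min c (F.max' hF)) with h1 | h1
  · rw [max_eq_right h1]
    rcases le_total c (F.max' hF) with h2 | h2
    · exact Or.inl (min_eq_left h2)
    · rw [min_eq_right h2]; exact Or.inr (F.max'_mem hF)
  · rw [max_eq_left h1]; exact Or.inr (F.min'_mem hF)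

omit [FloorRing K] in
/-- **THE GRID THEOREM.** In a grid format, every pre-rounding value on the grid (in range or not) has
an `L`-bit dyadic up-probability. -/
theorem dyadic_pUp_of_grid {F : Finset K} (hF : F.Nonempty) {u : K} (hu : 0 < u) {L : ℕ}
    (hG : GridFormat F u L) {c : K} (hc : OnGrid u c) : Dyadic L (pUp F c) := by
  have hc' : OnGrid u (clamp F c) := by
    rcases clamp_eq_self_or_mem hF c with h | h
    · rw [h]; exact hc
    · exact hG.1 _ h
  have hdmem : dn F c ∈ F := dn_mem hF c
  have humem : up F c ∈ F := up_mem hF c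
  have hdle : dn F c ≤ clamp F c := roundDown_le F _
  have hleu : clamp F c ≤ up F c := le_roundUp F _
  show Dyadic L (probUp F (clamp F c))
  unfold probUp
  change Dyadic L ((clamp F c - dn F c) / (up F c - dn F c))
  rcases eq_or_lt_of_le (hdle.trans hleu) with heq | hlt
  · refine ⟨0, ?_⟩; rw [← heq, sub_self, div_zero, zero_mul]; simp
  · rcases hG.2 _ hdmem _ humem hlt with ⟨z, hz, hz1, hz2⟩ | ⟨l, hl, he⟩
    · exact absurd hz (not_mem_of_between hz1 hz2)
    · obtain ⟨m, hm⟩ := hc'.sub (hG.1 _ hdmem)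
      have hl' : l ≤ L := Nat.lt_succ_iff.mp (Finset.mem_range.mp hl)
      refine ⟨m * 2 ^ (L - l), ?_⟩
      rw [hm, he]
      have h2l : (2 : K) ^ l ≠ 0 := pow_ne_zero _ two_ne_zero
      rw [show (2 : K) ^ L = 2 ^ l * 2 ^ (L - l) by rw [← pow_add, Nat.add_sub_cancel' hl']]
      push_cast
      field_simp

omit [FloorRing K] in
/-- Sums of grid values: the pair criterion of LXXVII for free. -/
theorem dyadic_pUp_add_of_grid {F : Finset K} (hF : F.Nonempty) {u : K} (hu : 0 < u) {L : ℕ}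
    (hG : GridFormat F u L) {a b : K} (ha : OnGrid u a) (hb : OnGrid u b) :
    Dyadic L (pUp F (a + b)) :=
  dyadic_pUp_of_grid hF hu hG (ha.add hb)

/-! ### Whole computations -/

/-- `LeavesSat P T`: every leaf of the summation tree satisfies `P`. -/
def LeavesSat (P : K → Prop) : STree K → Prop
  | .leaf x => P x
  | .node l r => LeavesSat P l ∧ LeavesSat P r

omit [Field K] [LinearOrder K] [IsStrictOrderedRing K] [FloorRing K] in
/-- Format-valued leaves satisfy any property the format has. -/
theorem leavesSat_of_leavesIn [LinearOrder K] {F : Finset K} {P : K → Prop} (hFP : ∀ x ∈ F, P x) :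
    ∀ T : STree K, LeavesIn F T → LeavesSat P T
  | .leaf _, h => hFP _ h
  | .node l r, ⟨hl, hr⟩ => ⟨leavesSat_of_leavesIn hFP l hl, leavesSat_of_leavesIn hFP r hr⟩

omit [IsStrictOrderedRing K] [FloorRing K] in
/-- If the leaves satisfy `P` and every format value does, every possible subtree value does. -/
theorem allOut_of_leavesSat {F : Finset K} (hF : F.Nonempty) {P : K → Prop} (hFP : ∀ x ∈ F, P x) :
    ∀ T : STree K, LeavesSat P T → AllOut F T P
  | .leaf _, h => h
  | .node l r, _ => allOut_mono F (.node l r) (fun _ hv => hFP _ hv) (allOut_mem_node F hF l r)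

omit [FloorRing K] in
/-- **Every tree with grid leaves is `L`-dyadic.** -/
theorem dyadicT_of_grid {F : Finset K} (hF : F.Nonempty) {u : K} (hu : 0 < u) {L : ℕ}
    (hG : GridFormat F u L) : ∀ T : STree K, LeavesSat (OnGrid u) T → DyadicT F L T
  | .leaf _, _ => trivial
  | .node l r, ⟨hl, hr⟩ => ⟨dyadicT_of_grid hF hu hG l hl, dyadicT_of_grid hF hu hG r hr,
      allOut_mono F l (fun _ ha => allOut_mono F r (fun _ hb => dyadic_pUp_add_of_grid hF hu hG ha hb)
        (allOut_of_leavesSat hF hG.1 r hr)) (allOut_of_leavesSat hF hG.1 l hl)⟩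

omit [FloorRing K] in
/-- **Trees.** In a grid format, any rule fixing the `L`-bit dyadics reproduces the exact-SR tree model
for every summation tree with grid leaves (format data in particular), in any order, for every test
function. -/
theorem treeExpQ_eq_treeExp_of_grid {F : Finset K} (hF : F.Nonempty) {u : K} (hu : 0 < u) {L : ℕ}
    (hG : GridFormat F u L) {q : K → K} (hq : ∀ η, Dyadic L η → q η = η) (T : STree K)
    (hT : LeavesSat (OnGrid u) T) (f : K → K) : treeExpQ F q T f = treeExp F T f :=
  treeExpQ_eq_treeExp_of_dyadicT F hq T f (dyadicT_of_grid hF hu hG T hT)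

omit [FloorRing K] in
/-- **Recursions.** If every update of a format state lands on the grid, the `N`-bit recursion is the
exact-SR recursion in law from every format start, for every horizon. -/
theorem recExpQ_eq_recExp_of_grid {F : Finset K} (hF : F.Nonempty) {u : K} (hu : 0 < u) {L : ℕ}
    (hG : GridFormat F u L) {q : K → K} (hq : ∀ η, Dyadic L η → q η = η) {g : ℕ → K → K}
    (hg : ∀ k, ∀ x ∈ F, OnGrid u (g k x)) {s : K} (hs : s ∈ F) (n : ℕ) (f : K → K) :
    recExpQ F q g n f s = recExp F g n f s :=
  recExpQ_eq_recExp_of_forall_mem hF hq (fun k x hx => dyadic_pUp_of_grid hF hu hG (hg k x hx)) hs n f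

omit [FloorRing K] in
/-- **Accumulation.** Grid increments (format data, or any multiples of the quantum) accumulated by
`N ≥ L`-bit SR from a format start: exact in law for every length and test function. -/
theorem accExpQ_eq_accExp_of_grid {F : Finset K} (hF : F.Nonempty) {u : K} (hu : 0 < u) {L : ℕ}
    (hG : GridFormat F u L) {q : K → K} (hq : ∀ η, Dyadic L η → q η = η) {c : ℕ → K}
    (hc : ∀ k, OnGrid u (c k)) {s : K} (hs : s ∈ F) (n : ℕ) (f : K → K) :
    accExpQ F q c n f s = accExp F c n f s := by
  rw [accExpQ_eq_recExpQ, accExp_eq_recExp]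
  exact recExpQ_eq_recExp_of_grid hF hu hG hq (fun k x hx => (hG.1 x hx).add (hc k)) hs n f

omit [FloorRing K] in
/-- **Inner products, one-stage.** If `u · 2^j = 1` (the quantum is `2^{-j}`), products of grid values
lie on the `u²`-grid, for which `F` is a grid format with budget `L + j`; so `N ≥ L + j` bits reproduce
the exact one-stage SR inner product `ŝ ← SR(ŝ + xₖyₖ)` in law. -/
theorem accExpQ_eq_accExp_of_grid_mul {F : Finset K} (hF : F.Nonempty) {u : K} (hu : 0 < u)
    {L j : ℕ} (hG : GridFormat F u L) (hj : u * 2 ^ j = 1) {q : K → K}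
    (hq : ∀ η, Dyadic (L + j) η → q η = η) {x y : ℕ → K} (hx : ∀ k, OnGrid u (x k))
    (hy : ∀ k, OnGrid u (y k)) {s : K} (hs : s ∈ F) (n : ℕ) (f : K → K) :
    accExpQ F q (fun k => x k * y k) n f s = accExp F (fun k => x k * y k) n f s :=
  have huv : u = 2 ^ j * (u * u) := by linear_combination (-u) * hj
  accExpQ_eq_accExp_of_grid hF (mul_pos hu hu) (gridFormat_refine huv hG) hq
    (fun k => (hx k).mul (hy k)) hs n f

omit [FloorRing K] in
/-- **Dot-product trees.** Likewise every summation tree whose leaves are products of grid values (or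
any values on the `u²`-grid) is exact in law with `N ≥ L + j` bits, in any order. -/
theorem treeExpQ_eq_treeExp_of_grid_mul {F : Finset K} (hF : F.Nonempty) {u : K} (hu : 0 < u)
    {L j : ℕ} (hG : GridFormat F u L) (hj : u * 2 ^ j = 1) {q : K → K}
    (hq : ∀ η, Dyadic (L + j) η → q η = η) (T : STree K) (hT : LeavesSat (OnGrid (u * u)) T)
    (f : K → K) : treeExpQ F q T f = treeExp F T f :=
  have huv : u = 2 ^ j * (u * u) := by linear_combination (-u) * hj
  treeExpQ_eq_treeExp_of_grid hF (mul_pos hu hu) (gridFormat_refine huv hG) hq T hT f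

end Generic

/-! ### Format instances: FP4 and FP6 are grid formats (kernel decisions) -/

section Instances

open FP4 Formats

/-- E2M1 is a grid format with quantum `½` and width budget `2` (`ulp_max/ulp_min = 2/(½) = 4`). -/
theorem e2m1_grid : GridFormat e2m1 (1/2 : ℚ) 2 := by decide +kernel

/-- E3M2 is a grid format with quantum `1/16` and width budget `6` (`4/(1/16) = 64`). -/
theorem e3m2_grid : GridFormat e3m2 (1/16 : ℚ) 6 := by decide +kernel

/-- E2M3 is a grid format with quantum `⅛` and width budget `2` (`(½)/(⅛) = 4`). -/
theorem e2m3_grid : GridFormat e2m3 (1/8 : ℚ) 2 := by decide +kernel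

/-- The width budgets are sharp: five bits do not fix `-28 + 1/16` in E3M2 (`θ = 1/64`), one bit does
not fix `-15/2 + ⅛` in E2M3 (`θ = ¼`); (FP4: `e2m1_pairs_oneBit_fails`). -/
theorem grid_budget_witnesses :
    ¬ Dyadic 5 (pUp e3m2 ((-28 : ℚ) + 1/16)) ∧ ¬ Dyadic 1 (pUp e2m3 ((-15/2 : ℚ) + 1/8)) := by
  refine ⟨by decide +kernel, by decide +kernel⟩

/-- **Six random bits reproduce exact SR on every E3M2 summation tree** (format-valued leaves, any
order, `A`/`B`/`C`, any `N ≥ 6`, every test function) — the certificate's `PAIRS e3m2 = 6` as a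
theorem, with no enumeration of the `3969` pairs. -/
theorem e3m2_sixBits_tree_exact {N : ℕ} (hN : 6 ≤ N) (T : STree ℚ) (hT : LeavesIn e3m2 T)
    (f : ℚ → ℚ) :
    treeExpQ e3m2 (probAwayA N) T f = treeExp e3m2 T f ∧
    treeExpQ e3m2 (probAwayB N) T f = treeExp e3m2 T f ∧
    treeExpQ e3m2 (probAwayC N) T f = treeExp e3m2 T f := by
  have hT' := leavesSat_of_leavesIn e3m2_grid.1 T hT
  obtain ⟨hA, hB, hC⟩ := probAwayABC_of_dyadic_le (K := ℚ) hN
  exact ⟨treeExpQ_eq_treeExp_of_grid e3m2_nonempty (by norm_num) e3m2_grid hA T hT' f,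
    treeExpQ_eq_treeExp_of_grid e3m2_nonempty (by norm_num) e3m2_grid hB T hT' f,
    treeExpQ_eq_treeExp_of_grid e3m2_nonempty (by norm_num) e3m2_grid hC T hT' f⟩

/-- **Two random bits reproduce exact SR on every E2M3 summation tree.** -/
theorem e2m3_twoBits_tree_exact {N : ℕ} (hN : 2 ≤ N) (T : STree ℚ) (hT : LeavesIn e2m3 T)
    (f : ℚ → ℚ) :
    treeExpQ e2m3 (probAwayA N) T f = treeExp e2m3 T f ∧
    treeExpQ e2m3 (probAwayB N) T f = treeExp e2m3 T f ∧
    treeExpQ e2m3 (probAwayC N) T f = treeExp e2m3 T f := by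
  have hT' := leavesSat_of_leavesIn e2m3_grid.1 T hT
  obtain ⟨hA, hB, hC⟩ := probAwayABC_of_dyadic_le (K := ℚ) hN
  exact ⟨treeExpQ_eq_treeExp_of_grid e2m3_nonempty (by norm_num) e2m3_grid hA T hT' f,
    treeExpQ_eq_treeExp_of_grid e2m3_nonempty (by norm_num) e2m3_grid hB T hT' f,
    treeExpQ_eq_treeExp_of_grid e2m3_nonempty (by norm_num) e2m3_grid hC T hT' f⟩

/-- **Ten random bits reproduce the exact one-stage E3M2 inner product** `ŝ ← SR(ŝ + xₖyₖ)` of E3M2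
vectors in law (every length, every E3M2 start, every test function; `6 + 4`, quantum `2⁻⁴`); ten are
needed (`e3m2_ip_threshold_witnesses` of LXXVIII: `-28 + 1/256`). -/
theorem e3m2_tenBits_ip_exact {N : ℕ} (hN : 10 ≤ N) {x y : ℕ → ℚ} (hx : ∀ k, x k ∈ e3m2)
    (hy : ∀ k, y k ∈ e3m2) {s : ℚ} (hs : s ∈ e3m2) (n : ℕ) (f : ℚ → ℚ) :
    accExpQ e3m2 (probAwayA N) (fun k => x k * y k) n f s = accExp e3m2 (fun k => x k * y k) n f s ∧
    accExpQ e3m2 (probAwayB N) (fun k => x k * y k) n f s = accExp e3m2 (fun k => x k * y k) n f s ∧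
    accExpQ e3m2 (probAwayC N) (fun k => x k * y k) n f s = accExp e3m2 (fun k => x k * y k) n f s := by
  obtain ⟨hA, hB, hC⟩ := probAwayABC_of_dyadic_le (K := ℚ) hN
  have hj : (1/16 : ℚ) * 2 ^ 4 = 1 := by norm_num
  exact ⟨accExpQ_eq_accExp_of_grid_mul e3m2_nonempty (by norm_num) e3m2_grid hj hA
      (fun k => e3m2_grid.1 _ (hx k)) (fun k => e3m2_grid.1 _ (hy k)) hs n f,
    accExpQ_eq_accExp_of_grid_mul e3m2_nonempty (by norm_num) e3m2_grid hj hB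
      (fun k => e3m2_grid.1 _ (hx k)) (fun k => e3m2_grid.1 _ (hy k)) hs n f,
    accExpQ_eq_accExp_of_grid_mul e3m2_nonempty (by norm_num) e3m2_grid hj hC
      (fun k => e3m2_grid.1 _ (hx k)) (fun k => e3m2_grid.1 _ (hy k)) hs n f⟩

/-- **Five random bits reproduce the exact one-stage E2M3 inner product** (`2 + 3`, quantum `2⁻³`);
five are needed (`e2m3_ip_threshold_witnesses`: `-15/2 + 1/64`). -/
theorem e2m3_fiveBits_ip_exact {N : ℕ} (hN : 5 ≤ N) {x y : ℕ → ℚ} (hx : ∀ k, x k ∈ e2m3)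
    (hy : ∀ k, y k ∈ e2m3) {s : ℚ} (hs : s ∈ e2m3) (n : ℕ) (f : ℚ → ℚ) :
    accExpQ e2m3 (probAwayA N) (fun k => x k * y k) n f s = accExp e2m3 (fun k => x k * y k) n f s ∧
    accExpQ e2m3 (probAwayB N) (fun k => x k * y k) n f s = accExp e2m3 (fun k => x k * y k) n f s ∧
    accExpQ e2m3 (probAwayC N) (fun k => x k * y k) n f s = accExp e2m3 (fun k => x k * y k) n f s := by
  obtain ⟨hA, hB, hC⟩ := probAwayABC_of_dyadic_le (K := ℚ) hN
  have hj : (1/8 : ℚ) * 2 ^ 3 = 1 := by norm_num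
  exact ⟨accExpQ_eq_accExp_of_grid_mul e2m3_nonempty (by norm_num) e2m3_grid hj hA
      (fun k => e2m3_grid.1 _ (hx k)) (fun k => e2m3_grid.1 _ (hy k)) hs n f,
    accExpQ_eq_accExp_of_grid_mul e2m3_nonempty (by norm_num) e2m3_grid hj hB
      (fun k => e2m3_grid.1 _ (hx k)) (fun k => e2m3_grid.1 _ (hy k)) hs n f,
    accExpQ_eq_accExp_of_grid_mul e2m3_nonempty (by norm_num) e2m3_grid hj hC
      (fun k => e2m3_grid.1 _ (hx k)) (fun k => e2m3_grid.1 _ (hy k)) hs n f⟩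

/-- **FP4 in one line**: three bits for every one-stage FP4 inner product (LXXVIII's 1369-entry table
`e2m1Products_pairs_dyadic_three`, now from `e2m1_grid`: `2 + 1`, quantum `2⁻¹`). -/
theorem e2m1_threeBits_ip_exact_of_grid {N : ℕ} (hN : 3 ≤ N) {x y : ℕ → ℚ} (hx : ∀ k, x k ∈ e2m1)
    (hy : ∀ k, y k ∈ e2m1) {s : ℚ} (hs : s ∈ e2m1) (n : ℕ) (f : ℚ → ℚ) :
    accExpQ e2m1 (probAwayA N) (fun k => x k * y k) n f s = accExp e2m1 (fun k => x k * y k) n f s ∧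
    accExpQ e2m1 (probAwayB N) (fun k => x k * y k) n f s = accExp e2m1 (fun k => x k * y k) n f s ∧
    accExpQ e2m1 (probAwayC N) (fun k => x k * y k) n f s = accExp e2m1 (fun k => x k * y k) n f s := by
  obtain ⟨hA, hB, hC⟩ := probAwayABC_of_dyadic_le (K := ℚ) hN
  have hj : (1/2 : ℚ) * 2 ^ 1 = 1 := by norm_num
  exact ⟨accExpQ_eq_accExp_of_grid_mul e2m1_nonempty (by norm_num) e2m1_grid hj hA
      (fun k => e2m1_grid.1 _ (hx k)) (fun k => e2m1_grid.1 _ (hy k)) hs n f,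
    accExpQ_eq_accExp_of_grid_mul e2m1_nonempty (by norm_num) e2m1_grid hj hB
      (fun k => e2m1_grid.1 _ (hx k)) (fun k => e2m1_grid.1 _ (hy k)) hs n f,
    accExpQ_eq_accExp_of_grid_mul e2m1_nonempty (by norm_num) e2m1_grid hj hC
      (fun k => e2m1_grid.1 _ (hx k)) (fun k => e2m1_grid.1 _ (hy k)) hs n f⟩

end Instances

end Summit.Ventures.CertifiedArithmetic.LowPrec.SR.LimitedBits
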